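import Literature.Combinatorics.Sahi2008.CumulationCone
import Literature.Combinatorics.Sahi2008.Symmetry
import Literature.Combinatorics.Sahi2008.Multilinear
import Literature.Combinatorics.Sahi2008.FKGCumulation
import Literature.Combinatorics.Sahi2008.TotalOrder
import Literature.Combinatorics.Sahi2008.UniformSquareAllOrders

/-!
# Sahi (2008), Conjecture 4 ⟺ Conjecture 5: the one-variable generating function
# (Lieb–Sahi 2022, Theorem 4.4), with Theorem 1 and Proposition 15 in their printed form

CITATION HEADER.  Sources: S. Sahi, *Higher correlation inequalities*, Combinatorica **28** (2008)
209–227 [Sahi2008] (author's reprint, corpus `paper:url-5f6060b183b5`; journal page = 208 + file page):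
the cones `𝒫 ⊂ ℝ⟦t⟧`, `𝒫[X]`, `ℐ[X]`, `𝒞[X]` (p. 209–210), Theorem 1 eq. (3) (p. 210), Conjectures 4
and 5 (p. 212), Proposition 12 eq. (13)–(14) (p. 219), the specialisation trick §3.2 (pp. 220–221),
Proposition 15 (p. 222).  E. H. Lieb, S. Sahi, *On the extension of the FKG inequality to `n`
functions*, J. Math. Phys. **63** (2022) [LiebSahi2021] (corpus `paper:arxiv-2107.09838`):
Conjectures 1.1/1.2, Appendix (Props. 4.2, 4.3, Theorem 4.4 "Conjectures (1.1) and (1.2) are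
equivalent").

## What is formalised (everything PROVED; no facts, no conjecture is asserted)

Sahi packages the inequalities `E_n ≥ 0` for all `n` into ONE positivity statement in `ℝ⟦t⟧`
[Sahi2008, p. 209: "to combine the entire family of inequalities (for all `n`) into a single statement
involving the ring of formal power series"]: for `𝒫`-valued `F : 2^X → tℝ⟦t⟧`, i.e. a sequence of real
functions `f_1, f_2, …` with `F(S) = Σ_{i≥1} f_i(S) t^i` (`genA`), the series
`1 - ∏_S (1 - F(S))^{μ(S)}` (`sahiSeries μ f`; the real power of `1 - u`, `u ∈ tℝ⟦t⟧`, is the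
binomial series — Mathlib's `PowerSeries.binomialSeries ℝ c = (1+X)^c` substituted at `-u`; this is
Lieb–Sahi's `1 - G(F)`, `G(F) = exp 𝔼 log F`).  **Conjecture 4** [Sahi2008]/**Conjecture 1.2**
[LiebSahi2021]: all its coefficients are `≥ 0` when the `f_i` are nonnegative monotone and `μ` is FKG;
**Conjecture 5**/**1.1**: `E_n(f_1,…,f_n) ≥ 0`.  The conjectures themselves are NOT stated here (tree
rule: obligations live under `Summits/`, see `Summits/…/Theorems/SahiGFConjecture.lean`); this file proves
their EQUIVALENCE and the printed theorems around it:

* `factorial_mul_coeff_sahiSeries` — the coefficient formula (Proposition 12 polarised + the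
  symmetrisation `t ↦ s_1 + ⋯ + s_M`, `symPow`): for a probability weight `μ`,
  `M!·[t^M] sahiSeries μ f = Σ_{T} E_{|T|}(|σ|!·f_{|σ|} : σ ∈ T)`, the sum over the families `T` of
  pairwise disjoint nonempty blocks tiling `{1,…,M}` (`blockFamilies`) — Lieb–Sahi's Proposition 4.3
  `1 - exp 𝔼 log(1 - Σ f_i t^i) = Σ_n Σ_{i_1,…,i_n} E_n(f_{i_1},…,f_{i_n}) t^{Σ i}/n!` with the
  multinomial count left as a sum over set partitions;
* `coeff_one_sub_prod_binomB_genB` / `coeff_one_sub_prod_binomB_lin` — **Proposition 12 at every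
  square-free monomial** (the tree's `sahiE_eq_gfE` is the top monomial): the coefficient of `t^τ` in
  `1 - ∏_x (1 - Σ_σ b_σ(x) t^σ)^{μ(x)}` is `Σ_{T ⊢ τ} E_{|T|}(b_σ : σ ∈ T)`;
* `coeff_sahiSeries_nonneg_of_forall_sahiE_nonneg` (Theorem 4.4 `⇒`: `E_n ≥ 0` on a class `ℐ` for
  all `n` gives nonnegative coefficients) and `sahiE_nonneg_of_forall_coeff_sahiSeries_nonneg`
  (Theorem 4.4 `⇐`, SAHI'S SPECIALISATION TRICK: distinct primes `p_j`, `k_j = ∏_{i≠j} p_i`,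
  `N = Σ k_j`; in `[t^N]` only the block families with exactly one block of each size `k_j` survive
  (`counts_eq_one`: "no `i_j` could be `0`, since otherwise the prime `p_j` would divide the left side
  but not the right"), each contributing `(∏ k_j!)·E_n(g)`); packaged as
  `forall_sahiE_nonneg_iff_forall_coeff_sahiSeries_nonneg` (any class `ℐ ∋ 0` on any finite
  probability space = [LiebSahi2021, Thm. 4.4]) and `forall_sahiPositive_iff_sahiSeries`
  (`(∀ n, SahiPositive μ n) ↔` nonnegative coefficients for all nonnegative monotone sequences);
* the PRINTED THEOREMS in their printed (power-series) form: **Theorem 1** [Sahi2008]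
  (`sahi2008_thm1_powerSeries`: product measure on `2^X`, `F ∈ 𝒞[X]`), **Proposition 15**
  [Sahi2008] verbatim — "Conjecture 4 holds for `|X| ≤ 2`" (`sahi2008_prop15_powerSeries`, from the
  tree's `SahiTwoPointLatticeTheorem_holds`), Blinovsky's FKG extension of Theorem 1
  (`sahiSeries_coeff_nonneg_of_isLatticeCumulation`), chains (`sahiSeries_coeff_nonneg_of_linearOrder`,
  [Blinovsky2013FormalSeries, Lemma 1]) and the uniform square grid (`sahiSeries_coeff_nonneg_uniformGrid`,
  [LiebSahi2021, Thm. 3.7/3.13]: Conjecture 1.2 for the discrete unit square).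

## Method and deviations from print

All algebra is done in the tree's square-free algebra `SqFree` (`CumulationCone.lean`), where Sahi's
Proposition 12 is available as `sahiE_eq_gfE`.  Part A is bookkeeping for `SqFree` (file-private:
coefficient lemmas, nilpotency, the substitution homomorphism `t_i ↦ m_i` for square-zero `m_i`, the
restriction homomorphism, coefficient extraction for monomial substitutions).  Part B derives
Proposition 12 at every monomial by the substitution `t_σ ↦ t^σ` from the linear case in variables
indexed by the nonempty subsets `σ`.  Part C maps `ℝ⟦t⟧` into `ℝ[s_1,…,s_M]/(s_j²)` by
`t ↦ s_1 + ⋯ + s_M` (`symPow M`, a ring homomorphism with `[s^τ] = |τ|!·[t^{|τ|}]`), under which the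
binomial series becomes the tree's `binomB` (`Ring.choose = rch`) — this replaces Sahi's `log`/`exp`
manipulation and Lieb–Sahi's cycle-type count (Lemma 4.1/Prop. 4.2) by Proposition 12, and is the only
deviation from the printed proofs; the specialisation trick (Part D) is Sahi's, verbatim, with the
existence of a tiling by consecutive blocks (`finSigmaFinEquiv`) supplying "the corresponding sum,
which is positive, reduces to the single term".  `f 0` is ignored throughout (`𝒫` has no constant
term); hypotheses on "all `f i`" therefore include a vacuous one on `f 0`.
-/

set_option autoImplicit false

namespace Literature.Combinatorics.Sahi2008

open Finset

namespace SqFree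

variable {ι : Type*} [DecidableEq ι] {R : Type*} [CommRing R]

/-! ## Part A.  Bookkeeping in the square-free algebra (file-private) -/

/-! ### Coefficient API (the corresponding lemmas of `CumulationCone.lean` are private there too) -/

omit [DecidableEq ι] [CommRing R] in
/-- Two elements with the same coefficients are equal. [folklore] -/
@[ext] private theorem ext' {a b : SqFree ι R} (h : ∀ τ, a.coeff τ = b.coeff τ) : a = b := by
  cases a; cases b; congr; funext τ; exact h τ

omit [DecidableEq ι] in
/-- Coefficients of `0`. [folklore] -/
@[simp] private theorem coeff_zero' (τ : Finset ι) : (0 : SqFree ι R).coeff τ = 0 := rfl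

omit [DecidableEq ι] in
/-- Coefficients are additive. [folklore] -/
@[simp] private theorem coeff_add' (a b : SqFree ι R) (τ : Finset ι) :
    (a + b).coeff τ = a.coeff τ + b.coeff τ := rfl

omit [DecidableEq ι] in
/-- Coefficients of a negation. [folklore] -/
@[simp] private theorem coeff_neg' (a : SqFree ι R) (τ : Finset ι) : (-a).coeff τ = -a.coeff τ := rfl

omit [DecidableEq ι] in
/-- Coefficients of a difference. [folklore] -/
@[simp] private theorem coeff_sub' (a b : SqFree ι R) (τ : Finset ι) :
    (a - b).coeff τ = a.coeff τ - b.coeff τ := rfl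

/-- Coefficients of `1` (the empty monomial). [folklore] -/
private theorem coeff_one' (τ : Finset ι) : (1 : SqFree ι R).coeff τ = if τ = ∅ then 1 else 0 := rfl

/-- Coefficients of a product: disjoint-union convolution. [folklore] -/
private theorem coeff_mul' (a b : SqFree ι R) (τ : Finset ι) :
    (a * b).coeff τ = ∑ σ ∈ τ.powerset, a.coeff σ * b.coeff (τ \ σ) := rfl

/-- Coefficients of a finite sum. [folklore] -/
@[simp] private theorem coeff_sum' {β : Type*} (s : Finset β) (g : β → SqFree ι R) (τ : Finset ι) :
    (∑ x ∈ s, g x).coeff τ = ∑ x ∈ s, (g x).coeff τ := by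
  induction s using Finset.cons_induction with
  | empty => rfl
  | cons x s hx ih => rw [sum_cons, sum_cons, coeff_add', ih]

/-- Coefficients of a monomial. [folklore] -/
private theorem coeff_single' (σ : Finset ι) (r : R) (τ : Finset ι) :
    (single σ r).coeff τ = if τ = σ then r else 0 := rfl

/-- Coefficients of a constant. [folklore] -/
private theorem coeff_C' (r : R) (τ : Finset ι) : (C r : SqFree ι R).coeff τ = if τ = ∅ then r else 0 := rfl

/-- Coefficients of a monomial times an element. [folklore] -/
private theorem coeff_single_mul' (σ : Finset ι) (r : R) (a : SqFree ι R) (τ : Finset ι) :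
    (single σ r * a).coeff τ = if σ ⊆ τ then r * a.coeff (τ \ σ) else 0 := by
  rw [coeff_mul']
  simp only [coeff_single', ite_mul, zero_mul]
  rw [Finset.sum_ite_eq' (τ.powerset) σ (fun x => r * a.coeff (τ \ x))]
  simp only [mem_powerset]

/-- Coefficients of a constant multiple. [folklore] -/
@[simp] private theorem coeff_C_mul' (r : R) (a : SqFree ι R) (τ : Finset ι) :
    (C r * a).coeff τ = r * a.coeff τ := by
  rw [show (C r : SqFree ι R) = single ∅ r from rfl, coeff_single_mul']; simp

/-- Product of two monomials: union of the index sets if disjoint, zero otherwise (`t_i² = 0`).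
[folklore] -/
private theorem single_mul_single' (σ σ' : Finset ι) (r r' : R) :
    single σ r * single σ' r' = if Disjoint σ σ' then single (σ ∪ σ') (r * r') else 0 := by
  ext τ
  rw [coeff_single_mul']
  split_ifs with h1 h2 h2
  · simp only [coeff_single']
    by_cases h3 : τ = σ ∪ σ'
    · subst h3
      simp [union_sdiff_left, sdiff_eq_self_of_disjoint h2.symm]
    · rw [if_neg, if_neg h3, mul_zero]
      intro h4
      apply h3
      rw [← h4, union_sdiff_of_subset h1]
  · simp only [coeff_single', coeff_zero']
    rw [if_neg, mul_zero]
    intro h4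
    apply h2
    rw [← h4]
    exact disjoint_sdiff
  · simp only [coeff_single']
    rw [if_neg]
    intro h3
    apply h1
    rw [h3]; exact subset_union_left
  · rfl

/-- A constant times a monomial. [folklore] -/
private theorem C_mul_single' (r : R) (σ : Finset ι) (s : R) : C r * single σ s = single σ (r * s) := by
  rw [show (C r : SqFree ι R) = single ∅ r from rfl, single_mul_single', if_pos (disjoint_empty_left _),
    empty_union]

/-- The zero monomial. [folklore] -/
@[simp] private theorem single_zero' (σ : Finset ι) : single σ (0 : R) = 0 := by
  ext τ; rw [coeff_single', coeff_zero']; split_ifs <;> rfl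

/-- Monomials are additive in the coefficient. [folklore] -/
private theorem single_add' (σ : Finset ι) (r s : R) : single σ (r + s) = single σ r + single σ s := by
  ext τ; simp only [coeff_single', coeff_add']; split_ifs <;> simp

/-- A monomial with nonempty index set has no constant term. [folklore] -/
private theorem isNil_single' {σ : Finset ι} (hσ : σ.Nonempty) (r : R) : (single σ r).IsNil := by
  unfold IsNil; rw [coeff_single', if_neg]; exact (nonempty_iff_ne_empty.1 hσ).symm

/-- Elements without constant term are closed under finite sums. [folklore] -/
private theorem IsNil.sum' {β : Type*} {s : Finset β} {g : β → SqFree ι R} (h : ∀ x ∈ s, (g x).IsNil) :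
    (∑ x ∈ s, g x).IsNil := by
  unfold IsNil at *
  rw [coeff_sum']
  exact Finset.sum_eq_zero h

omit [DecidableEq ι] in
/-- Elements without constant term are closed under negation. [folklore] -/
private theorem IsNil.neg' {a : SqFree ι R} (ha : a.IsNil) : (-a).IsNil := by
  unfold IsNil at *; rw [coeff_neg', ha, neg_zero]

/-! ### The degree filtration and nilpotency -/

omit [DecidableEq ι] in
/-- `a` has no monomials of degree `< k`. [folklore] -/
private def DegGe (k : ℕ) (a : SqFree ι R) : Prop := ∀ τ : Finset ι, τ.card < k → a.coeff τ = 0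

omit [DecidableEq ι] in
/-- No constant term iff no monomials of degree `< 1`. [folklore] -/
private theorem isNil_iff_degGe_one (a : SqFree ι R) : a.IsNil ↔ a.DegGe 1 := by
  constructor
  · intro h τ hτ
    rw [Nat.lt_one_iff, card_eq_zero] at hτ
    rw [hτ]; exact h
  · intro h; exact h ∅ (by simp)

/-- The filtration is multiplicative. [folklore] -/
private theorem DegGe.mul {j k : ℕ} {a b : SqFree ι R} (ha : a.DegGe j) (hb : b.DegGe k) :
    (a * b).DegGe (j + k) := by
  intro τ hτ
  rw [coeff_mul']
  refine Finset.sum_eq_zero fun σ hσ => ?_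
  have hστ := mem_powerset.1 hσ
  have hcard : (τ \ σ).card + σ.card = τ.card := card_sdiff_add_card_eq_card hστ
  by_cases h1 : σ.card < j
  · rw [ha σ h1, zero_mul]
  · have h2 : (τ \ σ).card < k := by omega
    rw [hb _ h2, mul_zero]

omit [DecidableEq ι] in
/-- Every element lies in degree `≥ 0`. [folklore] -/
private theorem degGe_zero (a : SqFree ι R) : a.DegGe 0 := fun _ h => (Nat.not_lt_zero _ h).elim

/-- Powers of an element without constant term climb the filtration. [folklore] -/
private theorem DegGe.pow {a : SqFree ι R} (ha : a.DegGe 1) (k : ℕ) : (a ^ k).DegGe k := by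
  induction k with
  | zero => exact degGe_zero _
  | succ k ih => rw [pow_succ]; exact ih.mul ha

omit [DecidableEq ι] in
/-- In `n` variables there are no monomials of degree `> n`. [folklore] -/
private theorem eq_zero_of_degGe [Fintype ι] {a : SqFree ι R} (h : a.DegGe (Fintype.card ι + 1)) :
    a = 0 := by
  ext τ
  exact h τ (Nat.lt_succ_of_le (card_le_univ τ))

/-- `u^k = 0` in `n < k` variables when `u` has no constant term. [folklore] -/
private theorem IsNil.pow_eq_zero_of_card_lt [Fintype ι] {a : SqFree ι R} (ha : a.IsNil) {k : ℕ}
    (hk : Fintype.card ι < k) : a ^ k = 0 :=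
  eq_zero_of_degGe fun τ hτ => ((isNil_iff_degGe_one a).1 ha).pow k τ (by omega)

/-- A product with a factor without constant term has no constant term. [folklore] -/
private theorem IsNil.mul_left' {a : SqFree ι R} (ha : a.IsNil) (b : SqFree ι R) : (a * b).IsNil := by
  unfold IsNil at *
  rw [coeff_mul', powerset_empty, sum_singleton, ha, zero_mul]

/-- A product with a factor without constant term has no constant term. [folklore] -/
private theorem IsNil.mul_right' {b : SqFree ι R} (hb : b.IsNil) (a : SqFree ι R) : (a * b).IsNil := by
  rw [mul_comm]; exact hb.mul_left' a

/-! ### Binomial powers do not depend on the truncation; transport along homomorphisms -/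

section Binom

variable [Algebra ℚ R] [Fintype ι]

/-- The binomial power `(1-u)^c = Σ_{k < N} C(c,k)(-u)^k` for any truncation `N` beyond the number of
variables. [folklore] -/
private theorem binomB_eq_sum_range {u : SqFree ι R} (hu : u.IsNil) (c : R) {N : ℕ}
    (hN : Fintype.card ι + 1 ≤ N) : binomB c u = ∑ k ∈ range N, C (rch k c) * (-u) ^ k := by
  obtain ⟨d, rfl⟩ := Nat.exists_eq_add_of_le hN
  induction d with
  | zero => rfl
  | succ d ih =>
    rw [← add_assoc, Finset.sum_range_succ, ← ih (by omega), (hu.neg').pow_eq_zero_of_card_lt (by omega),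
      mul_zero, add_zero]

/-- A ring homomorphism between square-free algebras fixing the constants and preserving the
augmentation ideal commutes with binomial powers. [folklore] -/
private theorem hom_binomB {κ : Type*} [DecidableEq κ] [Fintype κ] (Φ : SqFree ι R →+* SqFree κ R)
    (hΦ : ∀ r : R, Φ (C r) = C r) {u : SqFree ι R} (hu : u.IsNil) (hΦu : (Φ u).IsNil) (c : R) :
    Φ (binomB c u) = binomB c (Φ u) := by
  set N := max (Fintype.card ι + 1) (Fintype.card κ + 1) with hN
  rw [binomB_eq_sum_range hu c (le_max_left _ _ : Fintype.card ι + 1 ≤ N),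
    binomB_eq_sum_range hΦu c (le_max_right _ _ : Fintype.card κ + 1 ≤ N), map_sum]
  refine Finset.sum_congr rfl fun k _ => ?_
  rw [map_mul, hΦ, map_pow, map_neg]

end Binom

/-! ### The restriction homomorphism: kill the variables outside `S` -/

section Restrict

variable {V : Type*} [DecidableEq V]

/-- Restriction to the variables in `S`: the coefficient of `t^τ` is kept iff `τ ⊆ S`. [folklore] -/
def restrict (S : Finset V) : SqFree V R →+* SqFree V R where
  toFun a := ⟨fun τ => if τ ⊆ S then a.coeff τ else 0⟩
  map_one' := by
    ext τ
    simp only [coeff_one']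
    by_cases h : τ = ∅
    · subst h; simp
    · simp [h]
  map_mul' a b := by
    ext τ
    simp only [coeff_mul']
    by_cases hτ : τ ⊆ S
    · rw [if_pos hτ]
      refine Finset.sum_congr rfl fun σ hσ => ?_
      have hσ' := mem_powerset.1 hσ
      rw [if_pos (hσ'.trans hτ), if_pos (sdiff_subset.trans hτ)]
    · rw [if_neg hτ]
      symm
      refine Finset.sum_eq_zero fun σ hσ => ?_
      have hσ' := mem_powerset.1 hσ
      by_cases h1 : σ ⊆ S
      · rw [if_pos h1, if_neg, mul_zero]
        intro h2
        exact hτ (fun x hx => by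
          by_cases hxσ : x ∈ σ
          · exact h1 hxσ
          · exact h2 (mem_sdiff.2 ⟨hx, hxσ⟩))
      · rw [if_neg h1, zero_mul]
  map_zero' := by ext τ; simp
  map_add' a b := by
    ext τ
    simp only [coeff_add']
    split_ifs <;> simp

/-- Coefficients of a restriction. [folklore] -/
@[simp] private theorem coeff_restrict (S : Finset V) (a : SqFree V R) (τ : Finset V) :
    (restrict S a).coeff τ = if τ ⊆ S then a.coeff τ else 0 := rfl

/-- Restriction fixes the constants. [folklore] -/
private theorem restrict_C (S : Finset V) (r : R) : restrict S (C r : SqFree V R) = C r := by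
  ext τ
  simp only [coeff_restrict, coeff_C']
  by_cases h : τ = ∅
  · subst h; simp
  · simp [h]

/-- Restriction of a monomial. [folklore] -/
private theorem restrict_single (S σ : Finset V) (r : R) :
    restrict S (single σ r) = if σ ⊆ S then single σ r else 0 := by
  ext τ
  rw [coeff_restrict, coeff_single']
  by_cases hσ : σ ⊆ S
  · rw [if_pos hσ, coeff_single']
    by_cases hτ : τ = σ
    · subst hτ; rw [if_pos hσ]
    · rw [if_neg hτ]; split_ifs <;> rfl
  · rw [if_neg hσ, coeff_zero']
    by_cases hτ : τ = σ
    · subst hτ; rw [if_neg hσ]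
    · rw [if_neg hτ]; split_ifs <;> rfl

/-- Restriction preserves the augmentation ideal. [folklore] -/
private theorem IsNil.restrict (S : Finset V) {a : SqFree V R} (ha : a.IsNil) : (restrict S a).IsNil := by
  unfold IsNil at *
  rw [coeff_restrict, ha]; simp

end Restrict

/-! ### The substitution homomorphism `t_i ↦ m_i` for square-zero `m_i` -/

section Blocks

variable {V : Type*} {κ : Type*}

/-- The blocks `φ(i)`, `i ∈ T`, are pairwise disjoint (the condition defining a set partition
`π = (π_1,…,π_l)` by its blocks). [cite: Sahi2008, p. 220 (set partitions `π` of `[n]`); LiebSahi2021,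
Appendix] -/
def PwDisj (φ : V → Finset κ) (T : Finset V) : Prop :=
  ∀ i ∈ T, ∀ j ∈ T, i ≠ j → Disjoint (φ i) (φ j)

/-- Pairwise disjointness is decidable. [folklore] -/
instance decidablePwDisj [DecidableEq V] [DecidableEq κ] (φ : V → Finset κ) (T : Finset V) :
    Decidable (PwDisj φ T) := by
  unfold PwDisj; infer_instance

/-- Pairwise disjointness passes to sub-families. [folklore] -/
private theorem PwDisj.mono {φ : V → Finset κ} {S T : Finset V} (h : PwDisj φ T) (hST : S ⊆ T) :
    PwDisj φ S :=
  fun i hi j hj hij => h i (hST hi) j (hST hj) hij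

end Blocks

section Subst

variable {V : Type*} {κ : Type*} [DecidableEq κ]

/-- The monomial `∏_{i ∈ T} m_i` of a family. [folklore] -/
def mprod (m : V → SqFree κ R) (T : Finset V) : SqFree κ R := ∏ i ∈ T, m i

/-- `mprod` of the empty family. [folklore] -/
@[simp] private theorem mprod_empty (m : V → SqFree κ R) : mprod m ∅ = 1 := prod_empty

/-- Monomials with nonempty index sets square to zero. [folklore] -/
private theorem single_one_mul_self {σ : Finset κ} (hσ : σ.Nonempty) :
    single σ (1 : R) * single σ 1 = 0 := by
  rw [single_mul_single', if_neg]
  exact fun h => hσ.ne_empty (disjoint_self.1 h)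

variable [DecidableEq V]

/-- `mprod` of an enlarged family. [folklore] -/
private theorem mprod_insert (m : V → SqFree κ R) {i : V} {T : Finset V} (hi : i ∉ T) :
    mprod m (insert i T) = m i * mprod m T := prod_insert hi

/-- Products of square-zero generators: `m^σ m^ρ = m^{σ ∪ ρ}` for disjoint index sets and `0`
otherwise. [folklore] -/
private theorem mprod_mul_mprod {m : V → SqFree κ R} (hm : ∀ i, m i * m i = 0) (σ ρ : Finset V) :
    mprod m σ * mprod m ρ = if Disjoint σ ρ then mprod m (σ ∪ ρ) else 0 := by
  split_ifs with h
  · rw [mprod, mprod, mprod, prod_union h]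
  · obtain ⟨i, hi⟩ : ∃ i, i ∈ σ ∧ i ∈ ρ := by
      rw [Finset.not_disjoint_iff] at h; exact h
    rw [mprod, mprod, ← Finset.mul_prod_erase σ m hi.1, ← Finset.mul_prod_erase ρ m hi.2]
    calc m i * (∏ x ∈ σ.erase i, m x) * (m i * ∏ x ∈ ρ.erase i, m x)
        = (m i * m i) * ((∏ x ∈ σ.erase i, m x) * ∏ x ∈ ρ.erase i, m x) := by ring
      _ = 0 := by rw [hm i, zero_mul]

/-- The monomial of a family of blocks: `∏_{i∈T} t^{φ(i)} = t^{⋃ φ(i)}` if the blocks are pairwise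
disjoint, `0` otherwise. [folklore] -/
private theorem mprod_single (φ : V → Finset κ) (T : Finset V) :
    mprod (fun i => single (φ i) (1 : R)) T = if PwDisj φ T then single (T.biUnion φ) 1 else 0 := by
  induction T using Finset.induction_on with
  | empty =>
    have h : PwDisj φ ∅ := fun i hi => absurd hi (Finset.notMem_empty i)
    rw [mprod_empty, if_pos h, Finset.biUnion_empty]
    rfl
  | insert i T hi ih =>
    rw [mprod_insert _ hi, ih]
    by_cases hT : PwDisj φ T
    · rw [if_pos hT]
      by_cases hd : Disjoint (φ i) (T.biUnion φ)
      · have hP : PwDisj φ (insert i T) := by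
          intro a ha b hb hab
          rw [Finset.mem_insert] at ha hb
          rcases ha with rfl | ha <;> rcases hb with rfl | hb
          · exact absurd rfl hab
          · exact (Finset.disjoint_biUnion_right _ _ _).1 hd b hb
          · exact ((Finset.disjoint_biUnion_right _ _ _).1 hd a ha).symm
          · exact hT a ha b hb hab
        rw [if_pos hP, single_mul_single', if_pos hd, Finset.biUnion_insert, mul_one]
      · have hP : ¬ PwDisj φ (insert i T) := by
          intro hP
          apply hd
          rw [Finset.disjoint_biUnion_right]
          intro b hb
          exact hP i (Finset.mem_insert_self i T) b (Finset.mem_insert_of_mem hb)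
            (fun h => hi (h ▸ hb))
        rw [if_neg hP, single_mul_single', if_neg hd]
    · have hP : ¬ PwDisj φ (insert i T) := fun h => hT (h.mono (Finset.subset_insert i T))
      rw [if_neg hT, if_neg hP, mul_zero]

variable [Fintype V]

/-- **The substitution homomorphism.**  For square-zero elements `m_i` of a square-free algebra, the
assignment `t_i ↦ m_i` extends to a ring homomorphism `Σ_T a_T t^T ↦ Σ_T a_T ∏_{i∈T} m_i` (universal
property of `R[t_i]/(t_i²)` among commutative `R`-algebras). [folklore] -/
def subst (m : V → SqFree κ R) (hm : ∀ i, m i * m i = 0) : SqFree V R →+* SqFree κ R where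
  toFun a := ∑ T : Finset V, C (a.coeff T) * mprod m T
  map_one' := by
    rw [Finset.sum_eq_single_of_mem (∅ : Finset V) (mem_univ _)]
    · simp [coeff_one']
    · intro T _ hT
      rw [coeff_one', if_neg hT, map_zero, zero_mul]
  map_mul' a b := by
    -- right-hand side: expand and keep the disjoint pairs
    have eR : (∑ σ : Finset V, C (a.coeff σ) * mprod m σ) * (∑ ρ : Finset V, C (b.coeff ρ) * mprod m ρ)
        = ∑ σ : Finset V, ∑ ρ ∈ univ.filter (fun ρ => Disjoint σ ρ),
            C (a.coeff σ * b.coeff ρ) * mprod m (σ ∪ ρ) := by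
      rw [Finset.sum_mul_sum]
      refine Finset.sum_congr rfl fun σ _ => ?_
      rw [Finset.sum_filter]
      refine Finset.sum_congr rfl fun ρ _ => ?_
      calc C (a.coeff σ) * mprod m σ * (C (b.coeff ρ) * mprod m ρ)
          = C (a.coeff σ) * C (b.coeff ρ) * (mprod m σ * mprod m ρ) := by ring
        _ = _ := by
          rw [mprod_mul_mprod hm, ← map_mul]
          split_ifs <;> simp
    -- left-hand side as a sum over pairs `σ ⊆ T`
    have eL : ∑ T : Finset V, C ((a * b).coeff T) * mprod m T
        = ∑ T : Finset V, ∑ σ ∈ T.powerset, C (a.coeff σ * b.coeff (T \ σ)) * mprod m T := by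
      refine Finset.sum_congr rfl fun T _ => ?_
      rw [coeff_mul', map_sum, Finset.sum_mul]
    rw [eR, eL, Finset.sum_sigma', Finset.sum_sigma']
    refine Finset.sum_nbij' (fun p => ⟨p.2, p.1 \ p.2⟩) (fun q => ⟨q.1 ∪ q.2, q.1⟩) ?_ ?_ ?_ ?_ ?_
    · rintro ⟨T, σ⟩ hp
      rw [Finset.mem_sigma, Finset.mem_powerset] at hp
      rw [Finset.mem_sigma, Finset.mem_filter]
      exact ⟨mem_univ _, mem_univ _, disjoint_sdiff⟩
    · rintro ⟨σ, ρ⟩ hq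
      rw [Finset.mem_sigma, Finset.mem_filter] at hq
      rw [Finset.mem_sigma, Finset.mem_powerset]
      exact ⟨mem_univ _, subset_union_left⟩
    · rintro ⟨T, σ⟩ hp
      rw [Finset.mem_sigma, Finset.mem_powerset] at hp
      simp only [union_sdiff_of_subset hp.2]
    · rintro ⟨σ, ρ⟩ hq
      rw [Finset.mem_sigma, Finset.mem_filter] at hq
      simp only [union_sdiff_left, sdiff_eq_self_of_disjoint hq.2.2.symm]
    · rintro ⟨T, σ⟩ hp
      rw [Finset.mem_sigma, Finset.mem_powerset] at hp
      simp only [union_sdiff_of_subset hp.2]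
  map_zero' := by simp
  map_add' a b := by
    rw [← Finset.sum_add_distrib]
    refine Finset.sum_congr rfl fun T _ => ?_
    rw [coeff_add', map_add, add_mul]

/-- The defining formula of the substitution. [folklore] -/
private theorem subst_apply (m : V → SqFree κ R) (hm : ∀ i, m i * m i = 0) (a : SqFree V R) :
    subst m hm a = ∑ T : Finset V, C (a.coeff T) * mprod m T := rfl

/-- Substitution fixes the constants. [folklore] -/
private theorem subst_C (m : V → SqFree κ R) (hm : ∀ i, m i * m i = 0) (r : R) :
    subst m hm (C r) = C r := by
  rw [subst_apply, Finset.sum_eq_single_of_mem (∅ : Finset V) (mem_univ _)]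
  · simp [coeff_C']
  · intro T _ hT
    rw [coeff_C', if_neg hT, map_zero, zero_mul]

/-- Substitution on a monomial. [folklore] -/
private theorem subst_single (m : V → SqFree κ R) (hm : ∀ i, m i * m i = 0) (σ : Finset V) (r : R) :
    subst m hm (single σ r) = C r * mprod m σ := by
  rw [subst_apply, Finset.sum_eq_single_of_mem σ (mem_univ _)]
  · rw [coeff_single', if_pos rfl]
  · intro T _ hT
    rw [coeff_single', if_neg hT, map_zero, zero_mul]

/-- Substitution on a variable: `t_i ↦ m_i`. [folklore] -/
private theorem subst_single_singleton (m : V → SqFree κ R) (hm : ∀ i, m i * m i = 0) (i : V) (r : R) :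
    subst m hm (single {i} r) = C r * m i := by
  rw [subst_single, mprod, prod_singleton]

/-- Substitution by elements without constant term preserves the augmentation ideal. [folklore] -/
private theorem IsNil.subst {m : V → SqFree κ R} (hm : ∀ i, m i * m i = 0) (hm' : ∀ i, (m i).IsNil)
    {a : SqFree V R} (ha : a.IsNil) : (SqFree.subst m hm a).IsNil := by
  rw [subst_apply]
  refine IsNil.sum' fun T _ => ?_
  by_cases hT : T = ∅
  · subst hT
    unfold IsNil at ha ⊢
    rw [coeff_C_mul', ha, zero_mul]
  · obtain ⟨i, hi⟩ := Finset.nonempty_iff_ne_empty.2 hT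
    rw [mprod, ← Finset.mul_prod_erase T m hi, ← mul_assoc, mul_comm (C _), mul_assoc]
    exact (hm' i).mul_left' _

/-- **Coefficients of a monomial substitution.**  Under `t_i ↦ t^{φ(i)}` (`φ(i) ≠ ∅`), the coefficient
of `t^τ` in the image of `a = Σ_T a_T t^T` is the sum of `a_T` over the families `T` of pairwise
disjoint blocks `φ(i)`, `i ∈ T`, whose union is `τ`. [folklore] -/
private theorem coeff_subst_monomial (φ : V → Finset κ) (hφ : ∀ i, (φ i).Nonempty) (a : SqFree V R)
    (τ : Finset κ) :
    (subst (fun i => single (φ i) (1 : R)) (fun i => single_one_mul_self (hφ i)) a).coeff τ =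
      ∑ T ∈ univ.filter (fun T => PwDisj φ T ∧ T.biUnion φ = τ), a.coeff T := by
  rw [subst_apply, coeff_sum', Finset.sum_filter]
  refine Finset.sum_congr rfl fun T _ => ?_
  rw [coeff_C_mul', mprod_single]
  by_cases hP : PwDisj φ T
  · rw [if_pos hP, coeff_single']
    by_cases hτ : τ = T.biUnion φ
    · rw [if_pos hτ, if_pos ⟨hP, hτ.symm⟩, mul_one]
    · rw [if_neg hτ, if_neg (fun h => hτ h.2.symm), mul_zero]
  · rw [if_neg hP, coeff_zero', mul_zero, if_neg (fun h => hP h.1)]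

/-- **Renaming along an injection** `t_i ↦ t_{e(i)}`: the coefficient of `t^{e(T)}` in the image is
the coefficient of `t^T`. [folklore] -/
private theorem coeff_subst_singleton_map (e : V ↪ κ) (a : SqFree V R) (T : Finset V) :
    (subst (fun i => single ({e i} : Finset κ) (1 : R))
        (fun i => single_one_mul_self (Finset.singleton_nonempty (e i))) a).coeff (T.map e) =
      a.coeff T := by
  rw [coeff_subst_monomial (fun i => ({e i} : Finset κ)) (fun _ => Finset.singleton_nonempty _)]
  rw [Finset.sum_eq_single_of_mem T]
  · rw [Finset.mem_filter]
    refine ⟨mem_univ _, fun i _ j _ hij => ?_, ?_⟩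
    · rw [Finset.disjoint_singleton]; exact fun h => hij (e.injective h)
    · rw [Finset.biUnion_singleton, Finset.map_eq_image]
  · intro T' hT' hne
    exfalso
    apply hne
    rw [Finset.mem_filter] at hT'
    have h := hT'.2.2
    rw [Finset.biUnion_singleton, ← Finset.map_eq_image] at h
    exact Finset.map_injective e h

end Subst

end SqFree

/-! ### `E_{|T|}` of a family of functions indexed by a finset -/

section EOn

open SqFree

variable {α : Type*} [Fintype α] {V : Type*}

/-- Sahi's `E_{|T|}` of the functions `b_i`, `i ∈ T` (any enumeration of `T`; the value does not depend
on it by the symmetry of `E_n`). [cite: Sahi2008, eqs. (4)–(7) (p. 211); LiebSahi2021, Def. 3.1] -/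
noncomputable def sahiEOn (μ : α → ℝ) (T : Finset V) (b : V → α → ℝ) : ℝ :=
  sahiE μ T.card (fun i => b (T.equivFin.symm i))

/-- `sahiEOn` may be computed with any enumeration of `T`. [cite: Sahi2008, eqs. (4)–(7) (p. 211)
(symmetry of `E_n`)] -/
theorem sahiE_comp_equiv_eq_sahiEOn (μ : α → ℝ) (T : Finset V) (b : V → α → ℝ) (e : Fin T.card ≃ T) :
    sahiE μ T.card (fun i => b (e i)) = sahiEOn μ T b := by
  rw [sahiEOn]
  have key := sahiE_comp_perm μ T.card (e.trans T.equivFin) (fun j => b ((T.equivFin.symm j : T) : V))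
  refine Eq.trans ?_ key
  congr 1
  funext i
  simp

/-- `sahiEOn` of the empty family is the junk value `E_0 = 0`. [folklore] -/
private theorem sahiEOn_empty (μ : α → ℝ) (b : V → α → ℝ) : sahiEOn μ (∅ : Finset V) b = 0 :=
  sahiE_zero μ _

end EOn


/-! ## Part B.  Proposition 12 at every monomial (polarisation) -/

section Polarization

open SqFree

variable {α : Type*} [Fintype α]

/-- **Proposition 12 at every square-free monomial (linear generating function).**  For a probability
weight `μ` and functions `b_i` indexed by a finite type `V`, the coefficient of `t^T` in
`1 - ∏_x (1 - Σ_i t_i b_i(x))^{μ(x)}` is `E_{|T|}(b_i : i ∈ T)` — Sahi's Proposition 12 for the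
sub-family indexed by `T` (the variables outside `T` do not contribute to this coefficient).
[cite: Sahi2008, Prop. 12 (p. 219), eq. (14); LiebSahi2021, Prop. 4.3] -/
theorem coeff_one_sub_prod_binomB_lin {V : Type*} [DecidableEq V] [Fintype V] (μ : α → ℝ)
    (hμ : ∑ x, μ x = 1) (b : V → α → ℝ) (T : Finset V) :
    (1 - ∏ x, binomB (μ x) (∑ i : V, single ({i} : Finset V) (b i x))).coeff T = sahiEOn μ T b := by
  classical
  -- enumerate `T`
  set n := T.card with hn
  let e₀ : Fin n ≃ T := T.equivFin.symm
  have he_inj : Function.Injective (fun i : Fin n => ((e₀ i : T) : V)) := by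
    intro i j hij
    exact e₀.injective (Subtype.ext hij)
  let e : Fin n ↪ V := ⟨fun i => ((e₀ i : T) : V), he_inj⟩
  let f : Fin n → α → ℝ := fun i => b (e i)
  -- the two homomorphisms
  let Ren : SqFree (Fin n) ℝ →+* SqFree V ℝ :=
    subst (fun i : Fin n => single ({e i} : Finset V) (1 : ℝ))
      (fun i => single_one_mul_self (Finset.singleton_nonempty (e i)))
  let K : SqFree V ℝ →+* SqFree V ℝ := restrict T
  let L : α → SqFree V ℝ := fun x => ∑ i : V, single ({i} : Finset V) (b i x)
  let LT : α → SqFree V ℝ := fun x => ∑ j ∈ T, single ({j} : Finset V) (b j x)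
  have hRen_lin : ∀ x, Ren (lin f x) = LT x := by
    intro x
    rw [SqFree.lin, map_sum]
    simp only [Ren, subst_single_singleton, C_mul_single', mul_one]
    -- reindex the sum along `e`
    show ∑ i : Fin n, single ({e i} : Finset V) (b (e i) x) = ∑ j ∈ T, single ({j} : Finset V) (b j x)
    rw [show (∑ j ∈ T, single ({j} : Finset V) (b j x)) =
        ∑ j ∈ (univ : Finset (Fin n)).map e, single ({j} : Finset V) (b j x) from ?_]
    · rw [Finset.sum_map]
    · congr 1
      ext j
      simp only [Finset.mem_map, Finset.mem_univ, true_and]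
      constructor
      · intro hj
        exact ⟨e₀.symm ⟨j, hj⟩, by simp [e]⟩
      · rintro ⟨i, rfl⟩
        exact (e₀ i).2
  have hK_L : ∀ x, K (L x) = LT x := by
    intro x
    simp only [K, L, LT, map_sum, restrict_single, Finset.singleton_subset_iff]
    rw [← Finset.sum_filter]
    congr 1
    ext j; simp
  have hlin_nil : ∀ x, (lin f x).IsNil := fun x =>
    IsNil.sum' fun i _ => isNil_single' (Finset.singleton_nonempty i) _
  have hL_nil : ∀ x, (L x).IsNil := fun x =>
    IsNil.sum' fun i _ => isNil_single' (Finset.singleton_nonempty i) _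
  have hRenC : ∀ r : ℝ, Ren (C r) = C r := fun r => subst_C _ _ r
  have hKC : ∀ r : ℝ, K (C r) = C r := fun r => restrict_C T r
  have hRen_nil : ∀ x, (Ren (lin f x)).IsNil := fun x =>
    IsNil.subst _ (fun i => isNil_single' (Finset.singleton_nonempty (e i)) _) (hlin_nil x)
  have hK_nil : ∀ x, (K (L x)).IsNil := fun x => IsNil.restrict T (hL_nil x)
  have hEq : Ren (1 - ∏ x, binomB (μ x) (lin f x)) = K (1 - ∏ x, binomB (μ x) (L x)) := by
    rw [map_sub, map_one, map_prod, map_sub, map_one, map_prod]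
    congr 1
    refine Finset.prod_congr rfl fun x _ => ?_
    rw [hom_binomB Ren hRenC (hlin_nil x) (hRen_nil x), hom_binomB K hKC (hL_nil x) (hK_nil x),
      hRen_lin, hK_L]
  -- compare coefficients at `T = e(univ)`
  have hmap : (univ : Finset (Fin n)).map e = T := by
    ext j
    simp only [Finset.mem_map, Finset.mem_univ, true_and]
    constructor
    · rintro ⟨i, rfl⟩
      exact (e₀ i).2
    · intro hj
      exact ⟨e₀.symm ⟨j, hj⟩, by simp [e]⟩
  have h1 : (Ren (1 - ∏ x, binomB (μ x) (lin f x))).coeff T =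
      (1 - ∏ x, binomB (μ x) (lin f x)).coeff univ := by
    rw [← hmap]
    exact coeff_subst_singleton_map e _ univ
  have h2 : (K (1 - ∏ x, binomB (μ x) (L x))).coeff T = (1 - ∏ x, binomB (μ x) (L x)).coeff T := by
    show (SqFree.restrict T _).coeff T = _
    rw [coeff_restrict, if_pos (subset_refl T)]
  have h3 : (1 - ∏ x, binomB (μ x) (lin f x)).coeff univ = sahiE μ n f := by
    rw [sahiE_eq_gfE μ hμ]; rfl
  calc (1 - ∏ x, binomB (μ x) (L x)).coeff T
      = (Ren (1 - ∏ x, binomB (μ x) (lin f x))).coeff T := by rw [← h2, hEq]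
    _ = sahiE μ n f := by rw [h1, h3]
    _ = sahiEOn μ T b := sahiE_comp_equiv_eq_sahiEOn μ T b e₀

variable {κ : Type*} [DecidableEq κ] [Fintype κ]

/-- The nonempty finite subsets of `κ` (index set of the square-free monomials of positive degree).
[folklore] -/
abbrev NEFinset (κ : Type*) := {σ : Finset κ // σ.Nonempty}

/-- A square-free element without constant term whose coefficients are functions on `α`:
`B(x) = Σ_{σ ≠ ∅} b_σ(x) t^σ`. [cite: Sahi2008, §3.1 (p. 219): functions `2^X → R_n`] -/
def genB (b : NEFinset κ → α → ℝ) (x : α) : SqFree κ ℝ := ∑ σ : NEFinset κ, single σ.1 (b σ x)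

omit [Fintype α] in
/-- `genB` has no constant term. [folklore] -/
private theorem isNil_genB (b : NEFinset κ → α → ℝ) (x : α) : (genB b x).IsNil :=
  IsNil.sum' fun σ _ => isNil_single' σ.2 _

omit [Fintype α] in
/-- Coefficients of `genB`. [folklore] -/
private theorem coeff_genB (b : NEFinset κ → α → ℝ) (x : α) (τ : Finset κ) :
    (genB b x).coeff τ = if h : τ.Nonempty then b ⟨τ, h⟩ x else 0 := by
  rw [genB, coeff_sum']
  by_cases h : τ.Nonempty
  · rw [dif_pos h, Finset.sum_eq_single_of_mem (⟨τ, h⟩ : NEFinset κ) (mem_univ _)]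
    · rw [coeff_single', if_pos rfl]
    · intro σ _ hσ
      rw [coeff_single', if_neg]
      intro hτσ
      exact hσ (Subtype.ext hτσ.symm)
  · rw [dif_neg h]
    refine Finset.sum_eq_zero fun σ _ => ?_
    rw [coeff_single', if_neg]
    intro hτσ
    exact h (hτσ ▸ σ.2)

/-- The families of pairwise disjoint nonempty blocks with union `τ` ("block families of `τ`";
for `τ ≠ ∅` these are the set partitions of `τ`, for `τ = ∅` only the empty family). [folklore] -/
def blockFamilies (τ : Finset κ) : Finset (Finset (NEFinset κ)) :=
  univ.filter (fun T => PwDisj Subtype.val T ∧ T.biUnion Subtype.val = τ)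

omit [Fintype α] in
/-- Membership in `blockFamilies`: pairwise disjoint nonempty blocks with union `τ` (for `τ ≠ ∅`: the
set partitions of `τ`). [cite: Sahi2008, p. 220 (set partitions `π ⊢ [n]`); LiebSahi2021, Appendix] -/
theorem mem_blockFamilies {τ : Finset κ} {T : Finset (NEFinset κ)} :
    T ∈ blockFamilies τ ↔ PwDisj Subtype.val T ∧ T.biUnion Subtype.val = τ := by
  rw [blockFamilies, Finset.mem_filter]
  exact ⟨fun h => h.2, fun h => ⟨mem_univ _, h⟩⟩

/-- **Polarization (Sahi's Proposition 12 at every monomial, general coefficients).**  For a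
probability weight `μ` on a finite set and a square-free element `B(x) = Σ_{σ≠∅} b_σ(x) t^σ` with
function coefficients, the coefficient of `t^τ` in `1 - ∏_x (1 - B(x))^{μ(x)}` is the sum, over the
families `{σ_1,…,σ_n}` of pairwise disjoint nonempty blocks with `σ_1 ∪ ⋯ ∪ σ_n = τ`, of
`E_n(b_{σ_1},…,b_{σ_n})`.  (Linear `B`, `b_σ = 0` unless `|σ| = 1`: only the partition into
singletons survives and this is Proposition 12 verbatim; the general case follows by the substitution
`t_σ ↦ t^σ` from the linear case in the variables `t_σ`, `σ ≠ ∅` — it is the finite form of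
Lieb–Sahi's Proposition 4.3, `1 - exp E log(1 - A) = Σ_n Σ E_n(A,…,A)/n!` by multilinearity.)
[cite: Sahi2008, Prop. 12 (p. 219) and §3.2 (p. 220–221); LiebSahi2021, Prop. 4.3 (Appendix)] -/
theorem coeff_one_sub_prod_binomB_genB (μ : α → ℝ) (hμ : ∑ x, μ x = 1) (b : NEFinset κ → α → ℝ)
    (τ : Finset κ) :
    (1 - ∏ x, binomB (μ x) (genB b x)).coeff τ = ∑ T ∈ blockFamilies τ, sahiEOn μ T b := by
  classical
  let Sub : SqFree (NEFinset κ) ℝ →+* SqFree κ ℝ :=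
    subst (fun i : NEFinset κ => single (Subtype.val i) (1 : ℝ)) (fun i => single_one_mul_self i.2)
  let L : α → SqFree (NEFinset κ) ℝ := fun x => ∑ i : NEFinset κ, single ({i} : Finset (NEFinset κ)) (b i x)
  have hSubL : ∀ x, Sub (L x) = genB b x := by
    intro x
    simp only [Sub, L, map_sum, subst_single_singleton, C_mul_single', mul_one]
    rfl
  have hL_nil : ∀ x, (L x).IsNil := fun x =>
    IsNil.sum' fun i _ => isNil_single' (Finset.singleton_nonempty i) _
  have hSubC : ∀ r : ℝ, Sub (C r) = C r := fun r => subst_C _ _ r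
  have hSub_nil : ∀ x, (Sub (L x)).IsNil := fun x => by rw [hSubL]; exact isNil_genB b x
  have hEq : Sub (1 - ∏ x, binomB (μ x) (L x)) = 1 - ∏ x, binomB (μ x) (genB b x) := by
    rw [map_sub, map_one, map_prod]
    congr 1
    refine Finset.prod_congr rfl fun x _ => ?_
    rw [hom_binomB Sub hSubC (hL_nil x) (hSub_nil x), hSubL]
  rw [← hEq]
  show (subst (fun i : NEFinset κ => single (Subtype.val i) (1 : ℝ)) (fun i => single_one_mul_self i.2)
    (1 - ∏ x, binomB (μ x) (L x))).coeff τ = _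
  rw [coeff_subst_monomial Subtype.val (fun i => i.2)]
  rw [blockFamilies]
  refine Finset.sum_congr rfl fun T _ => ?_
  exact coeff_one_sub_prod_binomB_lin μ hμ b T

end Polarization


/-! ## Part C.  Sahi's one-variable generating function and its symmetrisation -/

section GenFun

open SqFree PowerSeries

variable {α : Type*} [Fintype α]

/-- The `𝒫[X]`-valued function `A(x) = Σ_{i ≥ 1} f_i(x) t^i ∈ ℝ⟦t⟧` attached to a sequence of real
functions `f_1, f_2, …` (the entry `f 0` is ignored: elements of Sahi's cone `𝒫` have no constant
term). [cite: Sahi2008, p. 209–210 (the cones `𝒫`, `𝒫[X]`, `ℐ[X]`); LiebSahi2021, Conj. 1.2] -/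
noncomputable def genA (f : ℕ → α → ℝ) (x : α) : ℝ⟦X⟧ :=
  PowerSeries.mk fun i => if i = 0 then 0 else f i x

omit [Fintype α] in
/-- Coefficients of `A(x)`. [cite: Sahi2008, p. 209 (definition of `𝒫`)] -/
theorem coeff_genA (f : ℕ → α → ℝ) (x : α) (i : ℕ) :
    coeff i (genA f x) = if i = 0 then 0 else f i x := by
  rw [genA, coeff_mk]

omit [Fintype α] in
/-- `A(x)` has no constant term. [cite: Sahi2008, p. 209 (definition of `𝒫`)] -/
theorem constantCoeff_genA (f : ℕ → α → ℝ) (x : α) : constantCoeff (genA f x) = 0 := by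
  rw [← coeff_zero_eq_constantCoeff_apply, coeff_genA, if_pos rfl]

/-- **Sahi's generating function** (eq. (3) / (14) of [Sahi2008] in one variable, Lieb–Sahi's
`1 - G(F)`): `1 - ∏_x (1 - A(x))^{μ(x)} ∈ ℝ⟦t⟧`, `A(x) = Σ_{i≥1} f_i(x) t^i`, where the real power
`(1 - u)^c` of a series `1 - u`, `u ∈ tℝ⟦t⟧`, is the binomial series `Σ_k C(c,k)(-u)^k`
(Mathlib's `PowerSeries.binomialSeries ℝ c = (1+X)^c` substituted at `X = -u`).
[cite: Sahi2008, Thm. 1 eq. (3) (p. 210), Conj. 4 (p. 212), Prop. 12 eq. (14) (p. 219);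
LiebSahi2021, Conj. 1.2 (`G(F) = exp(𝔼 log F)`, `F = 1 - Σ f_i t^i`)] -/
noncomputable def sahiSeries (μ : α → ℝ) (f : ℕ → α → ℝ) : ℝ⟦X⟧ :=
  1 - ∏ x, (PowerSeries.binomialSeries ℝ (μ x)).subst (-genA f x)

/-- **Symmetrisation** `t ↦ s_1 + ⋯ + s_M` into the square-free algebra in `M` variables (`t^k ↦
k!·e_k(s)`, `t^{M+1} ↦ 0`): the coefficient of `s^τ` is `|τ|!` times the coefficient of `t^{|τ|}`.
A ring homomorphism (Vandermonde: `Σ_{σ ⊆ τ, |σ| = k} 1 = C(|τ|, k)`).  This realises Sahi's passage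
between the one-variable series and its polarisation [Sahi2008, §3.2] inside `ℝ[s_1..s_M]/(s_j²)`.
[cite: Sahi2008, §3.1–3.2 (pp. 219–221)] -/
noncomputable def symPow (M : ℕ) : ℝ⟦X⟧ →+* SqFree (Fin M) ℝ where
  toFun a := ⟨fun τ => (τ.card.factorial : ℝ) * coeff τ.card a⟩
  map_one' := by
    ext τ
    show (τ.card.factorial : ℝ) * coeff τ.card (1 : ℝ⟦X⟧) = (1 : SqFree (Fin M) ℝ).coeff τ
    rw [coeff_one', PowerSeries.coeff_one]
    by_cases h : τ = ∅
    · subst h; simp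
    · have h' : τ.card ≠ 0 := fun h0 => h (Finset.card_eq_zero.1 h0)
      rw [if_neg h', if_neg h, mul_zero]
  map_mul' a b := by
    ext τ
    show (τ.card.factorial : ℝ) * coeff τ.card (a * b) =
      ((⟨fun σ => (σ.card.factorial : ℝ) * coeff σ.card a⟩ : SqFree (Fin M) ℝ) *
        ⟨fun σ => (σ.card.factorial : ℝ) * coeff σ.card b⟩).coeff τ
    rw [coeff_mul', PowerSeries.coeff_mul, Finset.Nat.sum_antidiagonal_eq_sum_range_succ_mk,
      Finset.mul_sum]
    dsimp only
    set G : ℕ → ℝ := fun k => (k.factorial : ℝ) * coeff k a *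
      (((τ.card - k).factorial : ℝ) * coeff (τ.card - k) b) with hG
    have hR : ∑ σ ∈ τ.powerset, (σ.card.factorial : ℝ) * coeff σ.card a *
          (((τ \ σ).card.factorial : ℝ) * coeff (τ \ σ).card b)
        = ∑ σ ∈ τ.powerset, G σ.card := by
      refine Finset.sum_congr rfl fun σ hσ => ?_
      rw [hG, Finset.card_sdiff_of_subset (Finset.mem_powerset.1 hσ)]
    have key : ∑ σ ∈ τ.powerset, G σ.card = ∑ k ∈ range (τ.card + 1), (τ.card.choose k) • G k :=
      Finset.sum_powerset_apply_card G
    rw [hR, key]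
    refine Finset.sum_congr rfl fun k hk => ?_
    have hk' : k ≤ τ.card := Nat.lt_succ_iff.mp (Finset.mem_range.mp hk)
    have hfac : ((τ.card.choose k : ℕ) : ℝ) * (k.factorial : ℝ) * ((τ.card - k).factorial : ℝ) =
        (τ.card.factorial : ℝ) := by
      rw [← Nat.cast_mul, ← Nat.cast_mul, Nat.choose_mul_factorial_mul_factorial hk']
    rw [nsmul_eq_mul, ← hfac, hG]
    ring
  map_zero' := by
    ext τ
    show (τ.card.factorial : ℝ) * coeff τ.card (0 : ℝ⟦X⟧) = (0 : SqFree (Fin M) ℝ).coeff τ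
    rw [map_zero, mul_zero, coeff_zero']
  map_add' a b := by
    ext τ
    show (τ.card.factorial : ℝ) * coeff τ.card (a + b) =
      (τ.card.factorial : ℝ) * coeff τ.card a + (τ.card.factorial : ℝ) * coeff τ.card b
    rw [map_add, mul_add]

/-- Coefficients of the symmetrisation. [cite: Sahi2008, §3.2 (p. 220–221)] -/
theorem coeff_symPow (M : ℕ) (a : ℝ⟦X⟧) (τ : Finset (Fin M)) :
    (symPow M a).coeff τ = (τ.card.factorial : ℝ) * coeff τ.card a := rfl

/-- The top coefficient of the symmetrisation is `M!·[t^M]`. [cite: Sahi2008, §3.2 (p. 220–221)] -/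
theorem coeff_symPow_univ (M : ℕ) (a : ℝ⟦X⟧) :
    (symPow M a).coeff univ = (M.factorial : ℝ) * coeff M a := by
  rw [coeff_symPow, Finset.card_univ, Fintype.card_fin]

/-- The symmetrisation commutes with substitution into a series: for `v ∈ tℝ⟦t⟧`,
`Ψ_M(p ∘ v) = Σ_{d ≤ M} p_d Ψ_M(v)^d`. [cite: Sahi2008, §3.2 (p. 220–221)] -/
theorem symPow_subst (M : ℕ) {v : ℝ⟦X⟧} (hv : constantCoeff v = 0) (p : ℝ⟦X⟧) :
    symPow M (p.subst v) = ∑ d ∈ range (M + 1), SqFree.C (coeff d p) * (symPow M v) ^ d := by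
  ext τ
  rw [coeff_symPow, coeff_sum', coeff_subst' (HasSubst.of_constantCoeff_zero' hv)]
  have hsupp : (Function.support fun d => coeff d p • coeff τ.card (v ^ d)) ⊆
      ↑(range (M + 1)) := by
    intro d hd
    rw [Function.mem_support] at hd
    rw [Finset.coe_range, Set.mem_Iio]
    by_contra hdM
    apply hd
    have hτM : τ.card ≤ M := (Finset.card_le_univ τ).trans (Fintype.card_fin M).le
    have hlt : τ.card < d := by omega
    rw [coeff_of_lt_order τ.card (lt_of_lt_of_le (by exact_mod_cast hlt)
      (le_order_pow_of_constantCoeff_eq_zero d hv)), smul_zero]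
  rw [finsum_eq_sum_of_support_subset _ hsupp, Finset.mul_sum]
  refine Finset.sum_congr rfl fun d _ => ?_
  rw [coeff_C_mul', ← map_pow, coeff_symPow, smul_eq_mul]
  ring

/-- The tree's generalised binomial coefficient `rch` is Mathlib's `Ring.choose` (over `ℝ`).
[folklore] -/
private theorem rch_eq_choose (k : ℕ) (c : ℝ) : rch k c = Ring.choose c k := by
  rw [Ring.choose_eq_smul, rch, smul_eq_mul, ← Polynomial.aeval_eq_smeval, Polynomial.aeval_def,
    Polynomial.eval₂_eq_eval_map, descPochhammer_map]
  congr 1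
  simp

/-- **The symmetrisation turns real powers of `1 - v` into the square-free binomial powers** of the
tree: `Ψ_M((1-v)^c) = binomB c (Ψ_M v)`. [cite: Sahi2008, §3.2 (p. 220–221) and eq. (12) (p. 218)] -/
theorem symPow_binomialSeries_subst (M : ℕ) (c : ℝ) {v : ℝ⟦X⟧} (hv : constantCoeff v = 0) :
    symPow M ((PowerSeries.binomialSeries ℝ c).subst (-v)) = binomB c (symPow M v) := by
  have hv' : constantCoeff (-v) = 0 := by rw [map_neg, hv, neg_zero]
  rw [symPow_subst M hv', binomB, Fintype.card_fin, map_neg]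
  refine Finset.sum_congr rfl fun d _ => ?_
  rw [binomialSeries_coeff, smul_eq_mul, mul_one, rch_eq_choose]

variable {M : ℕ}

/-- The polarised coefficient functions of the one-variable series: the block `σ` of the `M`
symmetrisation variables carries `|σ|!·f_{|σ|}`. [cite: Sahi2008, §3.2 (p. 220–221)] -/
noncomputable def blockFun (f : ℕ → α → ℝ) (σ : NEFinset (Fin M)) : α → ℝ :=
  (σ.1.card.factorial : ℝ) • f σ.1.card

omit [Fintype α] in
/-- Values of `blockFun`. [cite: Sahi2008, §3.2 (p. 220–221)] -/
theorem blockFun_apply (f : ℕ → α → ℝ) (σ : NEFinset (Fin M)) (x : α) :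
    blockFun f σ x = (σ.1.card.factorial : ℝ) * f σ.1.card x := rfl

omit [Fintype α] in
/-- The symmetrisation of `A(x)` is the square-free element with blocks `|σ|!·f_{|σ|}(x)`.
[cite: Sahi2008, §3.1–3.2 (pp. 219–221)] -/
theorem symPow_genA (f : ℕ → α → ℝ) (x : α) : symPow M (genA f x) = genB (blockFun f) x := by
  ext τ
  rw [coeff_symPow, coeff_genA, coeff_genB]
  by_cases h : τ.Nonempty
  · rw [dif_pos h, if_neg (Finset.card_ne_zero.2 h), blockFun_apply]
  · rw [dif_neg h, Finset.not_nonempty_iff_eq_empty.1 h, Finset.card_empty, if_pos rfl, mul_zero]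

/-- The symmetrisation of Sahi's series is the square-free polarised product.
[cite: Sahi2008, Prop. 12 (p. 219), §3.2 (p. 220–221)] -/
theorem symPow_sahiSeries (μ : α → ℝ) (f : ℕ → α → ℝ) :
    symPow M (sahiSeries μ f) = 1 - ∏ x, binomB (μ x) (genB (blockFun f) x) := by
  rw [sahiSeries, map_sub, map_one, map_prod]
  congr 1
  refine Finset.prod_congr rfl fun x _ => ?_
  rw [symPow_binomialSeries_subst M (μ x) (constantCoeff_genA f x), symPow_genA]

/-- **The coefficients of Sahi's one-variable series, polarised** (Proposition 12 + specialisation):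
for a probability weight `μ`, `M!·[t^M](1 - ∏_x (1 - Σ_i f_i(x)t^i)^{μ(x)})` is the sum, over the
families `{σ_1,…,σ_n}` of pairwise disjoint nonempty blocks tiling `{1,…,M}`, of
`E_n(|σ_1|!f_{|σ_1|},…,|σ_n|!f_{|σ_n|})` — Lieb–Sahi's
`[t^M](1 - exp 𝔼 log(1 - Σ f_i t^i)) = Σ_n Σ_{i_1+⋯+i_n = M} E_n(f_{i_1},…,f_{i_n})/n!` with the
multinomial bookkeeping left as a sum over block families.
[cite: Sahi2008, Prop. 12 (p. 219) and §3.2 (pp. 220–221); LiebSahi2021, Prop. 4.3] -/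
theorem factorial_mul_coeff_sahiSeries (μ : α → ℝ) (hμ : ∑ x, μ x = 1) (f : ℕ → α → ℝ) (M : ℕ) :
    (M.factorial : ℝ) * coeff M (sahiSeries μ f) =
      ∑ T ∈ blockFamilies (univ : Finset (Fin M)), sahiEOn μ T (blockFun f) := by
  rw [← coeff_symPow_univ, symPow_sahiSeries, coeff_one_sub_prod_binomB_genB μ hμ]

/-! ### `E_n` of a rescaled family; slots that vanish -/

/-- **Multilinearity, all slots at once:** `E_n(c_0 g_0,…,c_{n-1} g_{n-1}) = (∏ c_i)·E_n(g)`.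
[cite: Sahi2008, p. 211 ("`E_n` is a linear function of each `f_i`")] -/
theorem sahiE_smul_family (μ : α → ℝ) {n : ℕ} (c : Fin n → ℝ) (g : Fin n → α → ℝ) :
    sahiE μ n (fun i => c i • g i) = (∏ i, c i) * sahiE μ n g := by
  classical
  suffices h : ∀ S : Finset (Fin n),
      sahiE μ n (fun i => if i ∈ S then c i • g i else g i) = (∏ i ∈ S, c i) * sahiE μ n g by
    have := h univ
    simpa using this
  intro S
  induction S using Finset.induction_on with
  | empty => simp
  | insert j S hj ih =>
    have hupd : (fun i => if i ∈ insert j S then c i • g i else g i) =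
        Function.update (fun i => if i ∈ S then c i • g i else g i) j (c j • g j) := by
      funext i
      by_cases hij : i = j
      · subst hij
        rw [Function.update_self, if_pos (Finset.mem_insert_self i S)]
      · rw [Function.update_of_ne hij]
        by_cases hiS : i ∈ S
        · rw [if_pos (Finset.mem_insert_of_mem hiS), if_pos hiS]
        · rw [if_neg hiS, if_neg]
          rw [Finset.mem_insert, not_or]; exact ⟨hij, hiS⟩
    have hself : Function.update (fun i => if i ∈ S then c i • g i else g i) j (g j) =
        (fun i => if i ∈ S then c i • g i else g i) := by
      funext i
      by_cases hij : i = j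
      · subst hij; rw [Function.update_self, if_neg hj]
      · rw [Function.update_of_ne hij]
    rw [hupd, sahiE_update_smul, hself, ih, Finset.prod_insert hj, mul_assoc]

/-- A vanishing member kills `E_{|T|}`. [cite: Sahi2008, p. 211 (multilinearity)] -/
theorem sahiEOn_eq_zero_of_eq_zero (μ : α → ℝ) {V : Type*} {T : Finset V} {b : V → α → ℝ}
    {σ : V} (hσ : σ ∈ T) (hb : b σ = 0) : sahiEOn μ T b = 0 := by
  rw [sahiEOn]
  set i₀ : Fin T.card := T.equivFin ⟨σ, hσ⟩
  have h : (fun i => b (T.equivFin.symm i)) = Function.update (fun i => b (T.equivFin.symm i)) i₀ 0 := by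
    funext i
    by_cases hi : i = i₀
    · subst hi
      rw [Function.update_self]
      show b ((T.equivFin.symm (T.equivFin ⟨σ, hσ⟩) : T) : V) = 0
      rw [Equiv.symm_apply_apply]; exact hb
    · rw [Function.update_of_ne hi]
  rw [h, sahiE_update_zero]

/-- `E_{|T|}` of the polarised blocks is `(∏_σ |σ|!)·E_{|T|}(f_{|σ|} : σ ∈ T)`.
[cite: Sahi2008, p. 211 (multilinearity), §3.2 (p. 220–221)] -/
theorem sahiEOn_blockFun (μ : α → ℝ) (f : ℕ → α → ℝ) (T : Finset (NEFinset (Fin M))) :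
    sahiEOn μ T (blockFun f) =
      (∏ σ ∈ T, (σ.1.card.factorial : ℝ)) * sahiEOn μ T (fun σ => f σ.1.card) := by
  rw [sahiEOn, sahiEOn]
  have h : (fun i => blockFun f (T.equivFin.symm i : NEFinset (Fin M))) =
      fun i => ((T.equivFin.symm i : NEFinset (Fin M)).1.card.factorial : ℝ) •
        f (T.equivFin.symm i : NEFinset (Fin M)).1.card := rfl
  rw [h, sahiE_smul_family]
  congr 1
  rw [← Finset.prod_coe_sort T]
  exact Fintype.prod_equiv T.equivFin.symm _ _ (fun i => rfl)

/-- **Theorem 4.4 of Lieb–Sahi, direction `C ⇒` generating function** (Sahi: "Conjecture 5 for all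
`n` ⇒ Conjecture 4"; for cumulations this is how Theorem 2 sits inside Theorem 1): if `E_n ≥ 0` on all
`n`-tuples from a class `ℐ` of functions, then for every sequence `f_1, f_2, … ∈ ℐ` every
coefficient of `1 - ∏_x (1 - Σ_i f_i(x) t^i)^{μ(x)}` is `≥ 0`.
[cite: LiebSahi2021, Thm. 4.4 and Prop. 4.3 (Appendix); Sahi2008, Prop. 12 (p. 219)] -/
theorem coeff_sahiSeries_nonneg_of_forall_sahiE_nonneg (μ : α → ℝ) (hμ : ∑ x, μ x = 1)
    (P : (α → ℝ) → Prop) (hP : ∀ (n : ℕ) (g : Fin n → α → ℝ), (∀ i, P (g i)) → 0 ≤ sahiE μ n g)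
    (f : ℕ → α → ℝ) (hf : ∀ i, P (f i)) (M : ℕ) : 0 ≤ coeff M (sahiSeries μ f) := by
  have hM : (0 : ℝ) < M.factorial := by exact_mod_cast M.factorial_pos
  rw [← mul_nonneg_iff_of_pos_left hM, factorial_mul_coeff_sahiSeries μ hμ f M]
  refine Finset.sum_nonneg fun T _ => ?_
  rw [sahiEOn_blockFun]
  refine mul_nonneg (Finset.prod_nonneg fun σ _ => by positivity) ?_
  rw [sahiEOn]
  exact hP _ _ fun i => hf _

end GenFun


/-! ## Part D.  Sahi's specialisation trick: the generating function gives back `E_n` -/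

section PrimeTrick

open SqFree PowerSeries

variable {α : Type*} [Fintype α] {n : ℕ}

/-- Distinct primes `p_0 < p_1 < ⋯` indexed by `Fin n`. [cite: Sahi2008, §3.2 (p. 221): "we choose
distinct primes `p_1,…,p_n`"] -/
private noncomputable def pr (i : Fin n) : ℕ := Nat.nth Nat.Prime i

/-- The `p_i` are prime. [cite: Sahi2008, §3.2 (p. 221)] -/
private theorem pr_prime (i : Fin n) : (pr i).Prime := Nat.prime_nth_prime i

/-- The `p_i` are distinct. [cite: Sahi2008, §3.2 (p. 221)] -/
private theorem pr_injective : Function.Injective (pr : Fin n → ℕ) := fun _ _ h =>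
  Fin.ext (Nat.nth_injective Nat.infinite_setOf_prime h)

/-- The exponents `k_i = (p_1⋯p_n)/p_i = ∏_{j ≠ i} p_j`. [cite: Sahi2008, §3.2 (p. 221)] -/
private noncomputable def kk (i : Fin n) : ℕ := ∏ j ∈ univ.erase i, pr j

/-- `k_i > 0`. [cite: Sahi2008, §3.2 (p. 221)] -/
private theorem kk_pos (i : Fin n) : 0 < kk i := Finset.prod_pos fun j _ => (pr_prime j).pos

/-- `p_j ∣ k_i` for `j ≠ i`. [cite: Sahi2008, §3.2 (p. 221)] -/
private theorem pr_dvd_kk {i j : Fin n} (h : j ≠ i) : pr j ∣ kk i :=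
  Finset.dvd_prod_of_mem _ (Finset.mem_erase.2 ⟨h, Finset.mem_univ _⟩)

/-- `p_i ∤ k_i`. [cite: Sahi2008, §3.2 (p. 221)] -/
private theorem not_pr_dvd_kk (i : Fin n) : ¬ pr i ∣ kk i := by
  intro h
  obtain ⟨j, hj, hdvd⟩ := (Prime.dvd_finsetProd_iff (pr_prime i).prime _).1 h
  have hij : pr i = pr j := (Nat.prime_dvd_prime_iff_eq (pr_prime i) (pr_prime j)).1 hdvd
  exact (Finset.mem_erase.1 hj).1 (pr_injective hij).symm

/-- The exponents `k_i` are distinct. [cite: Sahi2008, §3.2 (p. 221)] -/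
private theorem kk_injective : Function.Injective (kk : Fin n → ℕ) := by
  intro i j h
  by_contra hij
  have h1 : pr i ∣ kk j := pr_dvd_kk hij
  rw [← h] at h1
  exact not_pr_dvd_kk i h1

/-- The arithmetic heart of the specialisation trick: if nonnegative multiplicities `c_i` satisfy
`Σ c_i k_i = Σ k_i` then every `c_i = 1` ("no `i_j` could be `0`, since otherwise the prime `p_j`
would divide the left side but not the right side; if all are `≥ 1` they must all equal `1`").
[cite: Sahi2008, §3.2 (p. 221); LiebSahi2021, proof of Thm. 4.4] -/
private theorem counts_eq_one (c : Fin n → ℕ) (h : ∑ i : Fin n, c i * kk i = ∑ i : Fin n, kk i) :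
    ∀ i, c i = 1 := by
  have hge : ∀ i, 1 ≤ c i := by
    intro i
    by_contra hc
    have hc0 : c i = 0 := by omega
    have hL : pr i ∣ ∑ j, c j * kk j := by
      refine Finset.dvd_sum fun j _ => ?_
      by_cases hji : j = i
      · rw [hji, hc0, zero_mul]; exact dvd_zero _
      · exact Dvd.dvd.mul_left (pr_dvd_kk (Ne.symm hji)) (c j)
    have hR : pr i ∣ ∑ j ∈ univ.erase i, kk j :=
      Finset.dvd_sum fun j hj => pr_dvd_kk (Finset.mem_erase.1 hj).1.symm
    rw [h, ← Finset.add_sum_erase univ kk (Finset.mem_univ i)] at hL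
    have hsub := Nat.dvd_sub hL hR
    rw [Nat.add_sub_cancel] at hsub
    exact not_pr_dvd_kk i hsub
  intro i
  by_contra hne
  have h2 : 2 ≤ c i := by have := hge i; omega
  have hlt : ∑ j : Fin n, kk j < ∑ j, c j * kk j := by
    calc ∑ j : Fin n, kk j = kk i + ∑ j ∈ univ.erase i, kk j :=
          (Finset.add_sum_erase univ kk (mem_univ i)).symm
      _ < c i * kk i + ∑ j ∈ univ.erase i, c j * kk j := by
          apply add_lt_add_of_lt_of_le
          · have := kk_pos i; nlinarith
          · exact Finset.sum_le_sum fun j _ => Nat.le_mul_of_pos_left _ (hge j)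
      _ = ∑ j, c j * kk j := Finset.add_sum_erase univ (fun j => c j * kk j) (mem_univ i)
  omega

/-- Transport of `E_n` along an equality of arities. [folklore] -/
private theorem sahiE_fin_cast (μ : α → ℝ) {m m' : ℕ} (h : m = m') (F : Fin m' → α → ℝ) :
    sahiE μ m (fun i => F (Fin.cast h i)) = sahiE μ m' F := by
  subst h; rfl

/-- **Theorem 4.4 of Lieb–Sahi, direction generating function `⇒ C`** (Sahi's specialisation trick,
[Sahi2008, §3.2]: with distinct primes `p_j`, `k_j = (∏ p)/p_j` and `N = Σ k_j`, the coefficient of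
`t^N` in `1 - ∏_x (1 - Σ_j g_j(x) t^{k_j})^{μ(x)}` is `E_n(g_1,…,g_n)`): if for every sequence
`f_1, f_2, …` in a class `ℐ ∋ 0` all coefficients of `1 - ∏_x(1 - Σ_i f_i(x)t^i)^{μ(x)}` are `≥ 0`,
then `E_n ≥ 0` on every `n`-tuple from `ℐ`. [cite: Sahi2008, §3.2 (pp. 220–221) and p. 212
("Conjecture 4 … implies … Conjecture 5"); LiebSahi2021, Thm. 4.4 (Appendix)] -/
theorem sahiE_nonneg_of_forall_coeff_sahiSeries_nonneg (μ : α → ℝ) (hμ : ∑ x, μ x = 1)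
    (P : (α → ℝ) → Prop) (hP0 : P 0)
    (h : ∀ f : ℕ → α → ℝ, (∀ i, P (f i)) → ∀ M, 0 ≤ coeff M (sahiSeries μ f))
    (g : Fin n → α → ℝ) (hg : ∀ i, P (g i)) : 0 ≤ sahiE μ n g := by
  classical
  -- the specialised sequence `f_{k_j} = g_j`, `f_m = 0` otherwise
  let f : ℕ → α → ℝ := fun m => ∑ j : Fin n, if kk j = m then g j else 0
  have hf_kk : ∀ i, f (kk i) = g i := by
    intro i
    show (∑ j : Fin n, if kk j = kk i then g j else 0) = g i
    rw [Finset.sum_eq_single_of_mem i (mem_univ i)]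
    · rw [if_pos rfl]
    · intro j _ hji; rw [if_neg (fun h => hji (kk_injective h))]
  have hf_other : ∀ m, (∀ i : Fin n, kk i ≠ m) → f m = 0 := by
    intro m hm
    show (∑ j : Fin n, if kk j = m then g j else 0) = 0
    exact Finset.sum_eq_zero fun j _ => if_neg (hm j)
  have hfP : ∀ m, P (f m) := by
    intro m
    by_cases hm : ∃ i : Fin n, kk i = m
    · obtain ⟨i, rfl⟩ := hm; rw [hf_kk]; exact hg i
    · rw [hf_other m (fun i hi => hm ⟨i, hi⟩)]; exact hP0
  -- `N = Σ k_i`; polarise the coefficient of `t^N`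
  have hfact : (0 : ℝ) < (∑ i : Fin n, kk i).factorial := by
    exact_mod_cast (∑ i : Fin n, kk i).factorial_pos
  have hcoef := h f hfP (∑ i : Fin n, kk i)
  rw [← mul_nonneg_iff_of_pos_left hfact, factorial_mul_coeff_sahiSeries μ hμ f] at hcoef
  -- good and bad block families
  let good : Finset (NEFinset (Fin (∑ i : Fin n, kk i))) → Prop :=
    fun T => ∀ σ ∈ T, ∃ i : Fin n, σ.1.card = kk i
  have hbad : ∀ T ∈ blockFamilies (univ : Finset (Fin (∑ i : Fin n, kk i))), ¬ good T →
      sahiEOn μ T (blockFun f) = 0 := by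
    intro T _ hT
    simp only [good, not_forall, not_exists] at hT
    obtain ⟨σ, hσ, hnot⟩ := hT
    apply sahiEOn_eq_zero_of_eq_zero μ hσ
    funext x
    rw [blockFun_apply, hf_other _ (fun i hi => hnot i hi.symm), Pi.zero_apply, mul_zero]
  have hgood : ∀ T ∈ blockFamilies (univ : Finset (Fin (∑ i : Fin n, kk i))), good T →
      sahiEOn μ T (blockFun f) = (∏ i : Fin n, ((kk i).factorial : ℝ)) * sahiE μ n g := by
    intro T hT hgT
    rw [mem_blockFamilies] at hT
    obtain ⟨hpw, hunion⟩ := hT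
    let c : Fin n → ℕ := fun i => (T.filter (fun σ => σ.1.card = kk i)).card
    have hsize : ∑ σ ∈ T, σ.1.card = ∑ i : Fin n, kk i := by
      have hpw' : (T : Set (NEFinset (Fin (∑ i : Fin n, kk i)))).PairwiseDisjoint Subtype.val :=
        fun i hi j hj hij => hpw i hi j hj hij
      rw [← Finset.card_biUnion hpw', hunion, Finset.card_univ, Fintype.card_fin]
    have hpick : ∀ σ ∈ T, ∀ (w : Fin n → ℕ), ∃ i : Fin n, σ.1.card = kk i ∧
        ∑ j : Fin n, (if σ.1.card = kk j then w j else 0) = w i := by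
      intro σ hσ w
      obtain ⟨i, hi⟩ := hgT σ hσ
      refine ⟨i, hi, ?_⟩
      rw [Finset.sum_eq_single_of_mem i (mem_univ i)]
      · rw [if_pos hi]
      · intro j _ hji
        exact if_neg (fun hj => hji (kk_injective (hj.symm.trans hi)))
    have hsum_c : ∑ σ ∈ T, σ.1.card = ∑ i, c i * kk i := by
      calc ∑ σ ∈ T, σ.1.card
          = ∑ σ ∈ T, ∑ i : Fin n, (if σ.1.card = kk i then kk i else 0) := by
            refine Finset.sum_congr rfl fun σ hσ => ?_
            obtain ⟨i, hi, hw⟩ := hpick σ hσ kk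
            rw [hw, hi]
        _ = ∑ i : Fin n, ∑ σ ∈ T, (if σ.1.card = kk i then kk i else 0) := Finset.sum_comm
        _ = ∑ i, c i * kk i := by
            refine Finset.sum_congr rfl fun i _ => ?_
            rw [← Finset.sum_filter, Finset.sum_const, smul_eq_mul]
    have hc1 : ∀ i, c i = 1 := counts_eq_one c (hsum_c.symm.trans hsize)
    have hTcard : T.card = n := by
      calc T.card = ∑ σ ∈ T, 1 := by simp
        _ = ∑ σ ∈ T, ∑ i : Fin n, (if σ.1.card = kk i then 1 else 0) := by
            refine Finset.sum_congr rfl fun σ hσ => ?_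
            obtain ⟨i, _, hw⟩ := hpick σ hσ (fun _ => 1)
            rw [hw]
        _ = ∑ i : Fin n, ∑ σ ∈ T, (if σ.1.card = kk i then 1 else 0) := Finset.sum_comm
        _ = ∑ i, c i := by
            refine Finset.sum_congr rfl fun i _ => ?_
            rw [← Finset.sum_filter, Finset.sum_const, smul_eq_mul, mul_one]
        _ = n := by simp [hc1]
    -- the block of size `k_i`
    have hblk : ∀ i : Fin n, ∃ σ, T.filter (fun σ => σ.1.card = kk i) = {σ} :=
      fun i => Finset.card_eq_one.1 (hc1 i)
    choose blk hblk using hblk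
    have hblk_mem : ∀ i : Fin n, blk i ∈ T ∧ (blk i).1.card = kk i := by
      intro i
      have hm : blk i ∈ T.filter (fun σ => σ.1.card = kk i) := by
        rw [hblk i]; exact Finset.mem_singleton_self _
      exact Finset.mem_filter.1 hm
    have hblk_inj : Function.Injective blk := by
      intro i j hij
      apply kk_injective
      rw [← (hblk_mem i).2, ← (hblk_mem j).2, hij]
    let e : Fin n → T := fun i => ⟨blk i, (hblk_mem i).1⟩
    have he_inj : Function.Injective e := fun i j hij => hblk_inj (congrArg Subtype.val hij)
    have he_bij : Function.Bijective e := by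
      rw [Fintype.bijective_iff_injective_and_card]
      exact ⟨he_inj, by rw [Fintype.card_fin, Fintype.card_coe, hTcard]⟩
    let E : Fin n ≃ T := Equiv.ofBijective e he_bij
    have hEOn : sahiEOn μ T (blockFun f) = sahiE μ n (fun i => blockFun f (blk i)) := by
      rw [← sahiE_comp_equiv_eq_sahiEOn μ T (blockFun f) ((finCongr hTcard).trans E)]
      exact sahiE_fin_cast μ hTcard (fun j => blockFun f (blk j))
    have hfun : (fun i => blockFun f (blk i)) = fun i : Fin n => ((kk i).factorial : ℝ) • g i := by
      funext i
      rw [blockFun, (hblk_mem i).2, hf_kk]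
    rw [hEOn, hfun, sahiE_smul_family]
  -- the sum over block families is (number of good families) × (∏ k_i!) × E_n(g)
  set BF := blockFamilies (univ : Finset (Fin (∑ i : Fin n, kk i))) with hBF
  have hsplit : ∑ T ∈ BF, sahiEOn μ T (blockFun f) =
      ((BF.filter good).card : ℝ) * ((∏ i : Fin n, ((kk i).factorial : ℝ)) * sahiE μ n g) := by
    rw [← Finset.sum_filter_add_sum_filter_not BF good]
    have h1 : ∑ T ∈ BF.filter good, sahiEOn μ T (blockFun f) =
        ∑ T ∈ BF.filter good, (∏ i : Fin n, ((kk i).factorial : ℝ)) * sahiE μ n g :=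
      Finset.sum_congr rfl fun T hT => hgood T (Finset.mem_filter.1 hT).1 (Finset.mem_filter.1 hT).2
    have h2 : ∑ T ∈ BF.filter (fun T => ¬ good T), sahiEOn μ T (blockFun f) = 0 :=
      Finset.sum_eq_zero fun T hT => hbad T (Finset.mem_filter.1 hT).1 (Finset.mem_filter.1 hT).2
    rw [h1, h2, add_zero, Finset.sum_const, nsmul_eq_mul]
  -- a good family exists: consecutive blocks of sizes `k_i`
  have hexists : 0 < (BF.filter good).card := by
    let ι₀ : (i : Fin n) → Fin (kk i) → Fin (∑ i : Fin n, kk i) := fun i x => finSigmaFinEquiv ⟨i, x⟩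
    have hι₀ : ∀ i, Function.Injective (ι₀ i) := by
      intro i x y hxy
      have hs : (⟨i, x⟩ : (i : Fin n) × Fin (kk i)) = ⟨i, y⟩ := finSigmaFinEquiv.injective hxy
      exact eq_of_heq (Sigma.mk.inj hs).2
    let σ₀ : Fin n → Finset (Fin (∑ i : Fin n, kk i)) := fun i => univ.map ⟨ι₀ i, hι₀ i⟩
    have hσ₀card : ∀ i, (σ₀ i).card = kk i := by
      intro i; simp [σ₀]
    have hσ₀ne : ∀ i, (σ₀ i).Nonempty := by
      intro i; rw [← Finset.card_pos, hσ₀card]; exact kk_pos i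
    have hmemσ₀ : ∀ i y, y ∈ σ₀ i ↔ ∃ x, ι₀ i x = y := by
      intro i y; simp [σ₀]
    let blk₀ : Fin n → NEFinset (Fin (∑ i : Fin n, kk i)) := fun i => ⟨σ₀ i, hσ₀ne i⟩
    let T₀ : Finset (NEFinset (Fin (∑ i : Fin n, kk i))) := univ.image blk₀
    have hT₀mem : ∀ σ, σ ∈ T₀ ↔ ∃ i, blk₀ i = σ := by
      intro σ; simp [T₀]
    have hT₀ : T₀ ∈ BF := by
      rw [hBF, mem_blockFamilies]
      constructor
      · intro σ hσ σ' hσ' hne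
        obtain ⟨i, rfl⟩ := (hT₀mem σ).1 hσ
        obtain ⟨i', rfl⟩ := (hT₀mem σ').1 hσ'
        have hii' : i ≠ i' := fun h => hne (h ▸ rfl)
        rw [Finset.disjoint_left]
        intro y hy hy'
        obtain ⟨x, rfl⟩ := (hmemσ₀ i y).1 hy
        obtain ⟨x', hx'⟩ := (hmemσ₀ i' _).1 hy'
        have hs : (⟨i', x'⟩ : (i : Fin n) × Fin (kk i)) = ⟨i, x⟩ := finSigmaFinEquiv.injective hx'
        exact hii' (Sigma.mk.inj hs).1.symm
      · rw [Finset.eq_univ_iff_forall]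
        intro y
        rw [Finset.mem_biUnion]
        obtain ⟨⟨i, x⟩, hix⟩ := finSigmaFinEquiv.surjective y
        exact ⟨blk₀ i, (hT₀mem _).2 ⟨i, rfl⟩, (hmemσ₀ i y).2 ⟨x, hix⟩⟩
    have hT₀good : good T₀ := by
      intro σ hσ
      obtain ⟨i, rfl⟩ := (hT₀mem σ).1 hσ
      exact ⟨i, hσ₀card i⟩
    exact Finset.card_pos.2 ⟨T₀, Finset.mem_filter.2 ⟨hT₀, hT₀good⟩⟩
  -- conclude
  rw [hsplit, ← mul_assoc] at hcoef
  have hpos : (0 : ℝ) < ((BF.filter good).card : ℝ) * ∏ i : Fin n, ((kk i).factorial : ℝ) := by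
    refine mul_pos (by exact_mod_cast hexists) (Finset.prod_pos fun i _ => ?_)
    exact_mod_cast (kk i).factorial_pos
  exact (mul_nonneg_iff_of_pos_left hpos).1 hcoef

/-- **Lieb–Sahi 2022, Theorem 4.4 (= equivalence of Sahi's Conjectures 4 and 5), for a fixed finite
probability space and a fixed class `ℐ ∋ 0` of functions:** `E_n(f_1,…,f_n) ≥ 0` for all `n` and all
`f_i ∈ ℐ` iff every coefficient of the power series `1 - ∏_x (1 - Σ_i f_i(x) t^i)^{μ(x)}`
(`= 1 - exp 𝔼 log(1 - Σ_i f_i t^i)`) is `≥ 0` for all sequences `f_1, f_2, … ∈ ℐ`.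
[cite: LiebSahi2021, Thm. 4.4 (Appendix); Sahi2008, p. 212 and §3.1–3.2 (pp. 219–221)] -/
theorem forall_sahiE_nonneg_iff_forall_coeff_sahiSeries_nonneg (μ : α → ℝ) (hμ : ∑ x, μ x = 1)
    (P : (α → ℝ) → Prop) (hP0 : P 0) :
    (∀ (n : ℕ) (g : Fin n → α → ℝ), (∀ i, P (g i)) → 0 ≤ sahiE μ n g) ↔
      ∀ f : ℕ → α → ℝ, (∀ i, P (f i)) → ∀ M, 0 ≤ coeff M (sahiSeries μ f) :=
  ⟨fun hE f hf M => coeff_sahiSeries_nonneg_of_forall_sahiE_nonneg μ hμ P hE f hf M,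
    fun hS _ g hg => sahiE_nonneg_of_forall_coeff_sahiSeries_nonneg μ hμ P hP0 hS g hg⟩

/-- **Sahi positivity of every order ⟺ positivity of the generating function** (the case
`ℐ = ` nonnegative monotone functions of Theorem 4.4): for a probability weight `μ` on a finite
preorder, `(∀ n, SahiPositive μ n)` iff for all sequences of nonnegative monotone `f_1, f_2, …` every
coefficient of `1 - ∏_x (1 - Σ_i f_i(x)t^i)^{μ(x)}` is nonnegative.
[cite: LiebSahi2021, Thm. 4.4 and Conjs. 1.1/1.2; Sahi2008, Conjs. 4/5 (p. 212)] -/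
theorem forall_sahiPositive_iff_sahiSeries [Preorder α] (μ : α → ℝ) (hμ : ∑ x, μ x = 1) :
    (∀ n, SahiPositive μ n) ↔
      ∀ f : ℕ → α → ℝ, (∀ i x, 0 ≤ f i x) → (∀ i, Monotone (f i)) →
        ∀ M, 0 ≤ coeff M (sahiSeries μ f) := by
  have key := forall_sahiE_nonneg_iff_forall_coeff_sahiSeries_nonneg μ hμ
    (fun g : α → ℝ => (∀ x, 0 ≤ g x) ∧ Monotone g) ⟨fun _ => le_rfl, monotone_const⟩
  constructor
  · intro hS f hf0 hfm M
    exact key.1 (fun n g hg => hS n g (fun i => (hg i).1) (fun i => (hg i).2)) f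
      (fun i => ⟨hf0 i, hfm i⟩) M
  · intro hG n g hg0 hgm
    exact key.2 (fun f hf M => hG f (fun i => (hf i).1) (fun i => (hf i).2) M) n g
      (fun i => ⟨hg0 i, hgm i⟩)

end PrimeTrick


/-! ## Part E.  The printed theorems in power-series form -/

section PrintedTheorems

open PowerSeries

/-- **Sahi 2008, Theorem 1** (printed form, one variable): for a product probability measure
`μ(S) = ∏_{x∈S} m_x ∏_{y∉S}(1-m_y)` on `2^X` and `F ∈ 𝒞[X]` — a `𝒫`-valued function all of whose
coefficient functions `f_i` are cumulations — every coefficient of `1 - ∏_S (1 - F(S))^{μ(S)}` is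
nonnegative.  (From the tree's Theorem 2 for all `n`, `sahi2008_thm2`, and Theorem 4.4 `⇒`.)
[cite: Sahi2008, Thm. 1, eq. (3) (p. 210)] -/
theorem sahi2008_thm1_powerSeries {ι : Type*} [DecidableEq ι] [Fintype ι] (m : ι → ℝ)
    (h0 : ∀ x, 0 ≤ m x) (h1 : ∀ x, m x ≤ 1) (F : ℕ → Finset ι → ℝ) (hF : ∀ i, IsCumulation (F i))
    (M : ℕ) : 0 ≤ coeff M (sahiSeries (finsetProdWeight m) F) :=
  coeff_sahiSeries_nonneg_of_forall_sahiE_nonneg _ (sum_finsetProdWeight m) IsCumulation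
    (fun n g hg => sahi2008_thm2 m h0 h1 n g hg) F hF M

/-- **Blinovsky's extension of Theorem 1 to FKG measures** (power-series form of
`sahiE_nonneg_of_isLatticeCumulation`): for an FKG probability weight on a finite distributive lattice and
coefficient functions in the cumulation cone, all coefficients of Sahi's series are nonnegative.
[cite: Blinovsky2013, eq. (ee3) (arXiv text p. 1); Sahi2008, Thm. 1 (p. 210) and Conj. 4 (p. 212)] -/
theorem sahiSeries_coeff_nonneg_of_isLatticeCumulation {β : Type*} [DistribLattice β] [Fintype β]
    [DecidableEq β] [DecidableLE β] {μ : β → ℝ} (hμ : IsFKGMeasure μ) (F : ℕ → β → ℝ)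
    (hF : ∀ i, IsLatticeCumulation (F i)) (M : ℕ) : 0 ≤ coeff M (sahiSeries μ F) :=
  coeff_sahiSeries_nonneg_of_forall_sahiE_nonneg μ hμ.sum_eq_one IsLatticeCumulation
    (fun _ g hg => sahiE_nonneg_of_isLatticeCumulation hμ g hg) F hF M

/-- **Sahi 2008, Proposition 15, verbatim: "Conjecture 4 holds for `|X| ≤ 2`."**  For a set `X` with
at most two elements, every FKG probability weight `μ` on `2^X` and every `F ∈ ℐ[X]` (nonnegative
monotone coefficient functions `f_i`), all coefficients of `1 - ∏_S (1 - F(S))^{μ(S)}` are nonnegative.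
(The tree's `SahiTwoPointLatticeTheorem_holds` is the `E_n` form; Theorem 4.4 `⇒` returns the printed
power-series statement.) [cite: Sahi2008, Prop. 15 (p. 222); LiebSahi2021, Thm. 4.4] -/
theorem sahi2008_prop15_powerSeries (X : Type) [Fintype X] (hX : Fintype.card X ≤ 2)
    (μ : Set X → ℝ) (hμ : IsFKGMeasure μ) (f : ℕ → Set X → ℝ) (hf0 : ∀ i ω, 0 ≤ f i ω)
    (hfm : ∀ i, Monotone (f i)) (M : ℕ) : 0 ≤ coeff M (sahiSeries μ f) :=
  (forall_sahiPositive_iff_sahiSeries μ hμ.sum_eq_one).1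
    (SahiTwoPointLatticeTheorem_holds X hX μ hμ) f hf0 hfm M

/-- **Chains** (power-series form of Blinovsky's Lemma 1): on a finite totally ordered set with any
probability weight, Sahi's series has nonnegative coefficients for all nonnegative monotone `f_i`.
[cite: Blinovsky2013FormalSeries, Lemma 1 (arXiv p. 1); LiebSahi2021, Thm. 4.4] -/
theorem sahiSeries_coeff_nonneg_of_linearOrder {β : Type*} [LinearOrder β] [Fintype β] {μ : β → ℝ}
    (hμ₀ : ∀ x, 0 ≤ μ x) (hμ₁ : ∑ x, μ x = 1) (f : ℕ → β → ℝ) (hf0 : ∀ i x, 0 ≤ f i x)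
    (hfm : ∀ i, Monotone (f i)) (M : ℕ) : 0 ≤ coeff M (sahiSeries μ f) :=
  (forall_sahiPositive_iff_sahiSeries μ hμ₁).1 (sahiPositive_of_linearOrder hμ₀ hμ₁) f hf0 hfm M

/-- **Lieb–Sahi 2022, Conjecture 1.2 for the discrete unit square** (power-series form of Theorem
3.7/3.13 via Theorem 4.4): under the uniform weight on `Fin m × Fin m`, Sahi's series has nonnegative
coefficients for all nonnegative monotone `f_i`. [cite: LiebSahi2021, Thm. 3.7, Thm. 3.13 and Thm. 4.4
("our Theorem (thm3) implies Conjecture (conj) for the Lebesgue measure on the unit square")] -/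
theorem sahiSeries_coeff_nonneg_uniformGrid {m : ℕ} (hm : 0 < m) (f : ℕ → Fin m × Fin m → ℝ)
    (hf0 : ∀ i x, 0 ≤ f i x) (hfm : ∀ i, Monotone (f i)) (M : ℕ) :
    0 ≤ coeff M (sahiSeries (LiebSahiGrid.gridWeight m) f) :=
  (forall_sahiPositive_iff_sahiSeries _ (LiebSahiGrid.isFKGMeasure_gridWeight hm).sum_eq_one).1
    (LiebSahiGrid.sahiPositive_uniformGrid hm) f hf0 hfm M

end PrintedTheorems

end Literature.Combinatorics.Sahi2008
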